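import Summits.CriticalPhenomena.SAWScalingLimit.Theorems.SAWDevelopingMapObservableToSLETypeLadderCarvedReductionSqueezeFamily
import Summits.CriticalPhenomena.SAWScalingLimit.Theorems.SAWDevelopingMapObservableToSLETypeLadderCarvedReductionSplice
import HarnessLib

/-!
# Free threshold rows and gate columns, spliced with the pinned gates (piece (T-A thr) of stub T-A
# `stub_carvedReduction_squeezeGeometry`)

Crux `SAWDevelopingMap.ObservableToSLE` (stmt-CriticalPhenomena-10472), line `six-class-type-ladder`,
stub T-A `stub_carvedReduction_squeezeGeometry`.  Landing target:
`Summits/CriticalPhenomena/SAWScalingLimit/Theorems/SAWDevelopingMapObservableToSLETypeLadderCarvedReductionSqueezeThresholds.lean`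
(`--supports stmt-CriticalPhenomena-10472`).

The two-piece admissible families (`twoPiece_exists_innerFamily[_deep]`) and their gate mid-edges
(`twoPiece_family_gates`) are driven, at each gate point `p`, by a GATE COLUMN `g δ : ℤ²` — the
up-face `(g δ, 0)` is the gate vertex at mesh `δ`, its row `m δ := g δ 1` the FREE THRESHOLD — subject
to: the gate face sits STRICTLY ABOVE the height of `p` at every mesh (`Im p < Im(δ c_{(g δ,0)})`,
whence every vertex at or below that height has row `< m δ`), and `δ c_{(g δ, 0)} → p` (whence the
rows `< m δ` lie below `Im p + ε` eventually).  In the squeeze the column is PRESCRIBED along the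
mesh sequence `s j` (the pinned gate up-faces of the realised cells, twin piece `…SqueezePinning`)
and free elsewhere; this file supplies
* `exists_upFace_near` — at every mesh a gate column within `δ` of `p` in both coordinates, strictly
  above (registered as `stub_carvedReduction_gateColumn`);
* `row_lt_of_im_le`, `im_lt_im_upFace_of_row_lt` — the two threshold inequalities of a column
  strictly above `p`;
* `exists_spliced_gateColumn` — the splice (`TypeLadder.eventually_splice` / `tendsto_splice`) of a
  prescribed sequence of columns (strictly above, converging to `p`) along a strictly decreasing
  positive mesh sequence with the free columns: it takes the prescribed values on the sequence and
  satisfies the four hypotheses `hm_lo`, `hm_hi`, `hg`, `hglim` of the family / gate lemmas.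
-/

noncomputable section

open scoped Topology
open Filter Set Metric
open Literature.Probability.LatticeModels (HexVertex hexGraph hexCenter Site)
open Literature.Probability.RandomPlanarGeometry
open Literature.Probability.Percolation (hexCenter_im hexCenter_re)

namespace Summit.CriticalPhenomena.SAWScalingLimit.Theorems.ObservableToSLE.TypeLadder

open Summit.CriticalPhenomena.SAWScalingLimit.Theorems.ObservableToSLE.FloorRatio
open Summit.CriticalPhenomena.SAWScalingLimit.Theorems.ObservableToSLER.TwoPiece (re_smul_hexCenter)

/-! ### Heights and abscissae of up-faces -/

/-- Height of the rescaled up-face of the cell `y`: `(y₁ + 1/3) δ√3/2`. -/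
theorem im_smul_hexCenter_upFace (δ : ℝ) (y : Site 2) :
    ((δ : ℂ) * hexCenter ((y, 0) : HexVertex)).im = ((y 1 : ℝ) + 1 / 3) * (δ * (Real.sqrt 3 / 2)) := by
  rw [im_smul_hexCenter]
  simp
  ring

/-- Abscissa of the rescaled up-face of the cell `y`: `δ (y₀ + y₁/2 + 1/2)`. -/
theorem re_smul_hexCenter_upFace (δ : ℝ) (y : Site 2) :
    ((δ : ℂ) * hexCenter ((y, 0) : HexVertex)).re = δ * ((y 0 : ℝ) + (y 1 : ℝ) / 2 + 1 / 2) := by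
  rw [re_smul_hexCenter]
  simp

/-- `δ√3/2 ≤ δ` for `0 ≤ δ`. -/
theorem mul_sqrt_three_div_two_le {δ : ℝ} (hδ : 0 ≤ δ) : δ * (Real.sqrt 3 / 2) ≤ δ := by
  have hs : Real.sqrt 3 / 2 ≤ 1 := by
    rw [div_le_one (by norm_num : (0:ℝ) < 2)]
    have := Real.sqrt_le_sqrt (show (3:ℝ) ≤ 4 by norm_num)
    rwa [show (4:ℝ) = 2 ^ 2 by norm_num, Real.sqrt_sq (by norm_num : (0:ℝ) ≤ 2)] at this
  nlinarith

/-! ### The two threshold inequalities of a column strictly above the gate point -/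

/-- **`hm_lo`.**  If the up-face `(g, 0)` sits strictly above the height `h` at mesh `δ > 0`, every
vertex at height `≤ h` has row `< g 1`. -/
theorem row_lt_of_im_le {δ h : ℝ} (hδ : 0 < δ) {g : Site 2}
    (habove : h < ((δ : ℂ) * hexCenter ((g, 0) : HexVertex)).im) (u : HexVertex)
    (hu : ((δ : ℂ) * hexCenter u).im ≤ h) : u.1 1 < g 1 := by
  by_contra hle
  push Not at hle
  have h1 := (row_le_iff_im hδ (g 1) u).1 hle
  rw [im_smul_hexCenter_upFace] at habove
  linarith

/-- **`hm_hi` (pointwise).**  A vertex of row `< g 1` lies strictly below the up-face `(g, 0)`. -/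
theorem im_lt_im_upFace_of_row_lt {δ : ℝ} (hδ : 0 < δ) {g : Site 2} {u : HexVertex} (hu : u.1 1 < g 1) :
    ((δ : ℂ) * hexCenter u).im < ((δ : ℂ) * hexCenter ((g, 0) : HexVertex)).im := by
  rw [im_smul_hexCenter_upFace]
  exact im_lt_of_row_lt hδ hu

/-! ### A column near a point, strictly above it -/

/-- **A gate column at every mesh.**  For every `p` there are cells `g δ` whose rescaled up-faces
sit strictly above the height of `p`, by at most `δ`, with abscissa within `δ` of `Re p`; hence
`δ c_{(g δ, 0)} → p` as `δ → 0⁺`. -/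
theorem exists_upFace_near (p : ℂ) :
    ∃ g : ℝ → Site 2,
      (∀ δ : ℝ, 0 < δ → p.im < ((δ : ℂ) * hexCenter ((g δ, 0) : HexVertex)).im) ∧
      (∀ δ : ℝ, 0 < δ → ((δ : ℂ) * hexCenter ((g δ, 0) : HexVertex)).im ≤ p.im + δ) ∧
      (∀ δ : ℝ, 0 < δ → |((δ : ℂ) * hexCenter ((g δ, 0) : HexVertex)).re - p.re| ≤ δ) ∧
      Tendsto (fun δ : ℝ => (δ : ℂ) * hexCenter ((g δ, 0) : HexVertex)) (𝓝[>] 0) (𝓝 p) := by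
  -- the row and the column
  set r : ℝ → ℤ := fun δ => ⌊p.im / (δ * (Real.sqrt 3 / 2)) - 1 / 3⌋ + 1 with hr
  set c : ℝ → ℤ := fun δ => ⌊p.re / δ - (r δ : ℝ) / 2 - 1 / 2⌋ with hc
  set g : ℝ → Site 2 := fun δ => ![c δ, r δ] with hg
  have hg0 : ∀ δ, g δ 0 = c δ := fun δ => by simp [hg]
  have hg1 : ∀ δ, g δ 1 = r δ := fun δ => by simp [hg]
  have him : ∀ δ : ℝ, 0 < δ → p.im < ((δ : ℂ) * hexCenter ((g δ, 0) : HexVertex)).im ∧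
      ((δ : ℂ) * hexCenter ((g δ, 0) : HexVertex)).im ≤ p.im + δ := by
    intro δ hδ
    rw [im_smul_hexCenter_upFace, hg1]
    set K : ℝ := δ * (Real.sqrt 3 / 2) with hK
    have hK0 : 0 < K := by positivity
    have hKδ : K ≤ δ := mul_sqrt_three_div_two_le hδ.le
    have h1 : p.im / K - 1 / 3 < (⌊p.im / K - 1 / 3⌋ : ℝ) + 1 := Int.lt_floor_add_one _
    have h2 : (⌊p.im / K - 1 / 3⌋ : ℝ) ≤ p.im / K - 1 / 3 := Int.floor_le _
    have h3 : ((r δ : ℝ)) = (⌊p.im / K - 1 / 3⌋ : ℝ) + 1 := by simp [hr, hK]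
    have h4 : p.im / K * K = p.im := div_mul_cancel₀ _ hK0.ne'
    constructor
    · have : (p.im / K) * K < ((r δ : ℝ) + 1 / 3) * K := mul_lt_mul_of_pos_right (by linarith) hK0
      linarith
    · have : ((r δ : ℝ) + 1 / 3) * K ≤ (p.im / K + 1) * K := mul_le_mul_of_nonneg_right (by linarith) hK0.le
      have h5 : (p.im / K + 1) * K = p.im + K := by rw [add_mul, h4, one_mul]
      linarith
  have hre : ∀ δ : ℝ, 0 < δ → |((δ : ℂ) * hexCenter ((g δ, 0) : HexVertex)).re - p.re| ≤ δ := by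
    intro δ hδ
    rw [re_smul_hexCenter_upFace, hg0, hg1]
    have h1 : p.re / δ - (r δ : ℝ) / 2 - 1 / 2 < (c δ : ℝ) + 1 := Int.lt_floor_add_one _
    have h2 : (c δ : ℝ) ≤ p.re / δ - (r δ : ℝ) / 2 - 1 / 2 := Int.floor_le _
    have h4 : p.re / δ * δ = p.re := div_mul_cancel₀ _ hδ.ne'
    rw [abs_le]
    constructor
    · have : (p.re / δ - 1) * δ ≤ ((c δ : ℝ) + (r δ : ℝ) / 2 + 1 / 2) * δ :=
        mul_le_mul_of_nonneg_right (by linarith) hδ.le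
      nlinarith
    · have : ((c δ : ℝ) + (r δ : ℝ) / 2 + 1 / 2) * δ ≤ (p.re / δ) * δ :=
        mul_le_mul_of_nonneg_right (by linarith) hδ.le
      nlinarith
  refine ⟨g, fun δ hδ => (him δ hδ).1, fun δ hδ => (him δ hδ).2, hre, ?_⟩
  -- the limit
  rw [Metric.tendsto_nhdsWithin_nhds]
  intro ε hε
  refine ⟨ε / 2, by positivity, fun δ hδ hδε => ?_⟩
  have hδ0 : 0 < δ := hδ
  rw [dist_zero_right, Real.norm_of_nonneg hδ0.le] at hδε
  calc dist ((δ : ℂ) * hexCenter ((g δ, 0) : HexVertex)) p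
      ≤ |(((δ : ℂ) * hexCenter ((g δ, 0) : HexVertex)) - p).re| +
          |(((δ : ℂ) * hexCenter ((g δ, 0) : HexVertex)) - p).im| := dist_le_abs_re_add_abs_im _ _
    _ ≤ δ + δ := by
        rw [Complex.sub_re, Complex.sub_im]
        refine add_le_add (hre δ hδ0) ?_
        rw [abs_le]
        constructor <;> linarith [(him δ hδ0).1, (him δ hδ0).2]
    _ < ε := by linarith

/-- **Registered sub-goal `stub_carvedReduction_gateColumn`** (crux item stmt-CriticalPhenomena-10472,
stub T-A `stub_carvedReduction_squeezeGeometry`, piece (T-A thr) A GATE COLUMN AT EVERY MESH): registry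
form of `exists_upFace_near`. -/
theorem stub_carvedReduction_gateColumn :
    ∀ p : ℂ, ∃ g : ℝ → Site 2,
      (∀ δ : ℝ, 0 < δ → p.im < ((δ : ℂ) * hexCenter ((g δ, 0) : HexVertex)).im) ∧
      (∀ δ : ℝ, 0 < δ → ((δ : ℂ) * hexCenter ((g δ, 0) : HexVertex)).im ≤ p.im + δ) ∧
      (∀ δ : ℝ, 0 < δ → |((δ : ℂ) * hexCenter ((g δ, 0) : HexVertex)).re - p.re| ≤ δ) ∧
      Tendsto (fun δ : ℝ => (δ : ℂ) * hexCenter ((g δ, 0) : HexVertex)) (𝓝[>] 0) (𝓝 p) :=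
  exists_upFace_near

/-! ### The spliced column -/

/-- **The spliced gate column.**  Along a strictly decreasing positive mesh sequence `s`, prescribe
columns `v j` whose up-faces sit strictly above the height of `p` at mesh `s j` and converge to `p`;
off the sequence take free columns.  The spliced column `G` agrees with `v` on the sequence, sits
strictly above `p` at every mesh, converges to `p`, and its row `G δ 1` satisfies the two threshold
hypotheses of the two-piece family: heights `≤ Im p` have row `< G δ 1` (every mesh), rows `< G δ 1`
have height `< Im p + ε` (eventually, every `ε > 0`). -/
theorem exists_spliced_gateColumn {s : ℕ → ℝ} (hs : StrictAnti s) (hspos : ∀ j, 0 < s j) (p : ℂ)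
    (v : ℕ → Site 2) (habove : ∀ j, p.im < ((s j : ℂ) * hexCenter ((v j, 0) : HexVertex)).im)
    (hlim : Tendsto (fun j => (s j : ℂ) * hexCenter ((v j, 0) : HexVertex)) atTop (𝓝 p)) :
    ∃ G : ℝ → Site 2,
      (∀ j, G (s j) = v j) ∧
      (∀ δ : ℝ, 0 < δ → p.im < ((δ : ℂ) * hexCenter ((G δ, 0) : HexVertex)).im) ∧
      Tendsto (fun δ : ℝ => (δ : ℂ) * hexCenter ((G δ, 0) : HexVertex)) (𝓝[>] 0) (𝓝 p) ∧
      (∀ (δ : ℝ) (u : HexVertex), 0 < δ → ((δ : ℂ) * hexCenter u).im ≤ p.im → u.1 1 < G δ 1) ∧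
      (∀ ε > (0 : ℝ), ∀ᶠ δ : ℝ in 𝓝[>] 0, ∀ u : HexVertex, u.1 1 < G δ 1 →
        ((δ : ℂ) * hexCenter u).im < p.im + ε) := by
  classical
  obtain ⟨g, hgabove, -, -, hglim⟩ := exists_upFace_near p
  set G : ℝ → Site 2 := fun δ => if h : ∃ i, s i = δ then v h.choose else g δ with hG
  have hGs : ∀ j, G (s j) = v j := fun j => splice_apply_seq hs v g j
  have hGabove : ∀ δ : ℝ, 0 < δ → p.im < ((δ : ℂ) * hexCenter ((G δ, 0) : HexVertex)).im := by
    intro δ hδ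
    by_cases h : ∃ i, s i = δ
    · obtain ⟨i, rfl⟩ := h
      rw [hGs]; exact habove i
    · have : G δ = g δ := splice_apply_of_forall_ne v g (fun i hi => h ⟨i, hi⟩)
      rw [this]; exact hgabove δ hδ
  have hGlim : Tendsto (fun δ : ℝ => (δ : ℂ) * hexCenter ((G δ, 0) : HexVertex)) (𝓝[>] 0) (𝓝 p) :=
    tendsto_splice hs hspos (F := fun δ (y : Site 2) => (δ : ℂ) * hexCenter ((y, 0) : HexVertex)) hlim hglim
  refine ⟨G, hGs, hGabove, hGlim, fun δ u hδ hu => row_lt_of_im_le hδ (hGabove δ hδ) u hu, fun ε hε => ?_⟩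
  have hev : ∀ᶠ δ : ℝ in 𝓝[>] 0, dist ((δ : ℂ) * hexCenter ((G δ, 0) : HexVertex)) p < ε :=
    hGlim (ball_mem_nhds p hε)
  filter_upwards [hev, self_mem_nhdsWithin] with δ hδ hδ0 u hu
  have h1 := im_lt_im_upFace_of_row_lt (show (0 : ℝ) < δ from hδ0) hu
  have h2 := im_sub_im_le_dist ((δ : ℂ) * hexCenter ((G δ, 0) : HexVertex)) p
  linarith

end Summit.CriticalPhenomena.SAWScalingLimit.Theorems.ObservableToSLE.TypeLadder

end
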